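import Summits.CriticalPhenomena.PercolationContinuityZ3.Theorems.PercNearOneGluingNoHeavyLowerTailLossyPocketCoverCore
import Summits.CriticalPhenomena.PercolationContinuityZ3.Theorems.PercNearOneGluingNoHeavyLowerTailCILReduction
import Summits.CriticalPhenomena.PercolationContinuityZ3.Theorems.PercNearOneGluingNoHeavyLowerTailPocketMoments
import HarnessLib

/-!
# `NoHeavyLowerTail` (stmt-CriticalPhenomena-4575) — the lossy pocket cover WITH ANY CONSTANT at any window
# level `|A|/m` (`m ≥ 3`) closes the crux (typed reduction)

Bookkeeping file (engine seat `prim-cplus-engine` g3; `--supports stmt-CriticalPhenomena-4575`).  No definitions,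
no named facts, no sorries.

The live reduction of the engine seat (memos `ENGINE-g2.md` §5, `ENGINE-g3.md` §1) is the single-fixed-witness LOSSY
POCKET COVER `Theorems.LossyPocket.lowerTail_le_add_of_inside`: for `o ∉ A`, a fixed relay `c ∈ A` and any slack
`Δ(W,R) ≥ 0` that pays, on each realised pocket state with `R ≠ ∅`, `c ∉ R`, the transfer
`μ{port block j-small inside Wᶜ} ≤ μ{c j-small in G[Wᶜ] + K_R} + Δ(W,R)`, one has
`μ{1 ≤ N ≤ j} ≤ μ({o ↔ A} ∩ {|π(c)| ≤ j}) + Σ_{W,R} Δ(W,R) μ(P_{W,R})`.  This file records that a bound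
`Σ_{W,R} Δ(W,R) μ(P_{W,R}) ≤ C·(μ(o ↮ A) + t)` (`t` the pairwise disconnection budget) at the level `j = ⌊|A|/m⌋`,
for SOME `c` and SOME admissible `Δ` per graph, with ANY constants `m ≥ 3`, `C ≥ 0`, already closes the crux:

* `LossyPocket.lowerTail_half_le_of_fewPortCover` — for one graph: the cover at level `⌊k/m⌋` plus the free middle
  window (`PocketMoments.window_le_pairSum`: `μ{⌊k/m⌋ < N ≤ k/2} ≤ (2m+8)·t`) and pair counting for the witness
  (`Theorems.smallBlock_le_two_mul`: `μ{|π(c)| ≤ k/2} ≤ 2t`) give `μ{0 < N, 2N ≤ k} ≤ (C + 4m + 10)(μ(o ↮ A) + t)`.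
* `noHeavyLowerTail_of_fewPortCoverConst` — hence `stub_fatMinorityLinear` (`d₀ = 0`) and the crux
  (`Theorems.noHeavyLowerTail_of_fatMinorityLinear`).
Dischargers of the per-state transfer (ways to choose `Δ`): the Kozma–Nitzan single-port slack
`(Φ_{Wᶜ}(v) − Φ_{Wᶜ}(c))⁺` (`LossyPocketT.blockSmall_le_gluedSmall_add_inside`, `…LossyPocketCoverKN.lean`), the block
slack with `ρ` (`LossyPocketT.blockSmall_le_gluedSmall_add_rho`), their per-state minimum, and `Δ = 0` on states with
`|R| > j` (`LossyPocketT.blockSmall_real_eq_zero_of_card_lt`).  Numerically (engine census after the `|R| ≤ j`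
correction, `ENGINE-g3.md` §1) the minimum over `c` of the Kozma–Nitzan few-port sum is `≤ 1.1·(t + μ(o ↮ A))` on every
instance found so far in the window `j ≤ |A|/4`; the existence of the good `c` is the open selection problem.
-/

noncomputable section

namespace Summit.CriticalPhenomena.PercolationContinuityZ3.Theorems

open MeasureTheory Set Literature.Probability.LatticeModels Literature.Probability.Percolation
open scoped Classical BigOperators

namespace LossyPocket

variable {n : ℕ}

/-- The pairwise budget summed: `Σ_a Σ_{b ≠ a} μ(a ↮ b) ≤ k²·t`. [folklore] -/
theorem pairSum_le_card_sq_mul (w : Sym2 (Fin n) → unitInterval) (A : Finset (Fin n)) (t : ℝ) (ht : 0 ≤ t)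
    (hpair : ∀ a ∈ A, ∀ a' ∈ A, (prodBernoulli w).real (openConn a a' : Set (BondConfig (Fin n)))ᶜ ≤ t) :
    ∑ a ∈ A, ∑ b ∈ A.erase a, (prodBernoulli w).real ((openConn a b : Set (BondConfig (Fin n)))ᶜ) ≤
      (A.card : ℝ) * (A.card : ℝ) * t := by
  calc ∑ a ∈ A, ∑ b ∈ A.erase a, (prodBernoulli w).real ((openConn a b : Set (BondConfig (Fin n)))ᶜ)
      ≤ ∑ a ∈ A, ∑ b ∈ A.erase a, t :=
        Finset.sum_le_sum fun a ha => Finset.sum_le_sum fun b hb => hpair a ha b (Finset.mem_of_mem_erase hb)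
    _ = ∑ a ∈ A, ((A.erase a).card : ℝ) * t := by simp [Finset.sum_const, nsmul_eq_mul]
    _ ≤ ∑ a ∈ A, (A.card : ℝ) * t := Finset.sum_le_sum fun a ha => by
        have : ((A.erase a).card : ℝ) ≤ A.card := by exact_mod_cast Finset.card_erase_le
        exact mul_le_mul_of_nonneg_right this ht
    _ = (A.card : ℝ) * (A.card : ℝ) * t := by simp [Finset.sum_const, nsmul_eq_mul]; ring

/-- Arithmetic of the large window: `(j+1)(k−j−1) ≥ k²/(2m+8)` when `k/m ≤ j+1`, `3j ≤ k`, `2m ≤ k`, `m ≥ 3`.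
[folklore] -/
theorem window_arith_low (k m J : ℝ) (hm : 3 ≤ m) (hkm : 2 * m ≤ k) (hJ1 : k ≤ m * J)
    (hJ2 : 3 * (J - 1) ≤ k) : k * k / (2 * m + 8) ≤ J * (k - J) := by
  have hk6 : 6 ≤ k := by linarith
  have hb : k / 2 ≤ k - J := by linarith
  have hmpos : (0:ℝ) < 2 * m + 8 := by linarith
  have hprod : k * (k / 2) ≤ (m * J) * (k - J) := mul_le_mul hJ1 hb (by linarith) (by nlinarith)
  rw [div_le_iff₀ hmpos]
  nlinarith

/-- Arithmetic of the large window: `⌊k/2⌋(k − ⌊k/2⌋) ≥ k²/(2m+8)` when `2m ≤ k`, `m ≥ 3`. [folklore] -/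
theorem window_arith_high (k m Q : ℝ) (hm : 3 ≤ m) (hkm : 2 * m ≤ k) (hQ1 : Q * 2 ≤ k)
    (hQ2 : k < Q * 2 + 2) : k * k / (2 * m + 8) ≤ Q * (k - Q) := by
  have hk6 : 6 ≤ k := by linarith
  have ha : k / 4 ≤ Q := by linarith
  have hb : k / 2 ≤ k - Q := by linarith
  have hmpos : (0:ℝ) < 2 * m + 8 := by linarith
  have hprod : (k / 4) * (k / 2) ≤ Q * (k - Q) := mul_le_mul ha hb (by linarith) (by linarith)
  rw [div_le_iff₀ hmpos]
  nlinarith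

/-- Arithmetic of the small window: `k² ≤ (k−1)(4m+8)` when `2 ≤ k < 2m`. [folklore] -/
theorem window_arith_small (k m : ℝ) (hk2 : 2 ≤ k) (hkm : k < 2 * m) : k * k ≤ (k - 1) * (4 * m + 8) := by
  nlinarith

/-- **One graph: the few-port cover at level `⌊k/m⌋` controls the whole lower half.**  `o ∉ A`, `k = |A| ≥ 1`,
`m ≥ 3`, pairwise budget `t ≥ 0`, a relay `c ∈ A` and an admissible slack `Δ` at level `j = k/m` with
`Σ Δ μ(P) ≤ C (μ(o ↮ A) + t)`.  Then `μ{0 < N, 2N ≤ k} ≤ (C + 4m + 10)(μ(o ↮ A) + t)`. [this work] -/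
theorem lowerTail_half_le_of_fewPortCover (w : Sym2 (Fin n) → unitInterval) (A : Finset (Fin n)) (o c : Fin n)
    (m : ℕ) (hm : 3 ≤ m) (C t : ℝ) (ht : 0 ≤ t) (hoA : o ∉ A) (hc : c ∈ A)
    (hpair : ∀ a ∈ A, ∀ a' ∈ A, (prodBernoulli w).real (openConn a a' : Set (BondConfig (Fin n)))ᶜ ≤ t)
    (Δ : Finset (Fin n) → Finset (Fin n) → ℝ) (hΔ0 : ∀ W N, 0 ≤ Δ W N)
    (hΔ : ∀ W N : Finset (Fin n),
      ({ω : BondConfig (Fin n) |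
          (Finset.univ.filter fun v => ω ∈ openConnIn ((↑A : Set (Fin n))ᶜ) o v) = W ∧
          (A.filter fun a => ω ∈ openConnIn (insert a ((↑A : Set (Fin n))ᶜ)) o a) = N} : Set _).Nonempty →
      N.Nonempty → c ∉ N →
        (prodBernoulli w).real {ω : BondConfig (Fin n) |
            (A.filter fun y => ∃ a ∈ N, ω ∈ openConnIn ((↑W : Set (Fin n))ᶜ) a y).card ≤ A.card / m} ≤
          (prodBernoulli w).real {ω : BondConfig (Fin n) |
            ((∃ a ∈ N, ω ∈ openConnIn ((↑W : Set (Fin n))ᶜ) c a) ∧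
                (A.filter fun y => ∃ a ∈ N, ω ∈ openConnIn ((↑W : Set (Fin n))ᶜ) a y).card ≤ A.card / m) ∨
              ((¬ ∃ a ∈ N, ω ∈ openConnIn ((↑W : Set (Fin n))ᶜ) c a) ∧
                (A.filter fun y => ω ∈ openConnIn ((↑W : Set (Fin n))ᶜ) c y).card ≤ A.card / m)} + Δ W N)
    (hsum : ∑ W : Finset (Fin n), ∑ N : Finset (Fin n), Δ W N *
          (prodBernoulli w).real {ω : BondConfig (Fin n) |
            (Finset.univ.filter fun v => ω ∈ openConnIn ((↑A : Set (Fin n))ᶜ) o v) = W ∧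
            (A.filter fun a => ω ∈ openConnIn (insert a ((↑A : Set (Fin n))ᶜ)) o a) = N} ≤
        C * ((prodBernoulli w).real (⋃ a ∈ A, (openConn o a : Set (BondConfig (Fin n))))ᶜ + t)) :
    (prodBernoulli w).real {ω : BondConfig (Fin n) |
        0 < (A.filter fun a => ω ∈ openConn o a).card ∧
          2 * (A.filter fun a => ω ∈ openConn o a).card ≤ A.card} ≤
      (C + 4 * m + 10) * ((prodBernoulli w).real (⋃ a ∈ A, (openConn o a : Set (BondConfig (Fin n))))ᶜ + t) := by
  set μ := prodBernoulli w with hμ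
  set k := A.card with hk
  set j := k / m with hj
  set δ₀ := μ.real (⋃ a ∈ A, (openConn o a : Set (BondConfig (Fin n))))ᶜ with hδ₀
  have hδ₀0 : 0 ≤ δ₀ := measureReal_nonneg
  have hk1 : 1 ≤ k := Finset.card_pos.2 ⟨c, hc⟩
  have hmr : (3 : ℝ) ≤ m := by exact_mod_cast hm
  have hkr1 : (1 : ℝ) ≤ k := by exact_mod_cast hk1
  -- the relay count of the observer
  set Nf : BondConfig (Fin n) → ℕ := fun ω => (A.filter fun a => ω ∈ openConn o a).card with hNf
  -- (1) the low part `{1 ≤ N ≤ j}` : cover + pair counting for the witness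
  have hlow : μ.real {ω : BondConfig (Fin n) | 1 ≤ Nf ω ∧ Nf ω ≤ j} ≤ 2 * t + C * (δ₀ + t) := by
    have hcov := lowerTail_le_add_of_inside w A o c j hoA hc Δ hΔ0 hΔ
    have hwit : μ.real ((⋃ a' ∈ A, (openConn o a' : Set (BondConfig (Fin n)))) ∩
        {ω : BondConfig (Fin n) | (A.filter fun x => ω ∈ openConn c x).card ≤ j}) ≤ 2 * t := by
      calc μ.real ((⋃ a' ∈ A, (openConn o a' : Set (BondConfig (Fin n)))) ∩
            {ω : BondConfig (Fin n) | (A.filter fun x => ω ∈ openConn c x).card ≤ j})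
          ≤ μ.real {ω : BondConfig (Fin n) | 2 * (A.filter fun a' => ω ∈ openConn c a').card ≤ A.card} := by
            refine measureReal_mono (fun ω hω => ?_) (measure_ne_top _ _)
            have h1 : (A.filter fun x => ω ∈ openConn c x).card ≤ j := hω.2
            show 2 * (A.filter fun a' => ω ∈ openConn c a').card ≤ A.card
            have h2 : 2 * j ≤ k := by
              rw [hj]
              calc 2 * (k / m) ≤ m * (k / m) := Nat.mul_le_mul_right _ (by omega)
                _ ≤ k := Nat.mul_div_le k m
            omega
        _ ≤ 2 * t := smallBlock_le_two_mul w A c t hc fun a' ha' => hpair c hc a' ha'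
    simpa only [hNf] using hcov.trans (by linarith)
  -- (2) the middle window `{j+1 ≤ N ≤ k/2}` : pair counting (free)
  have hpairs := pairSum_le_card_sq_mul w A t ht hpair
  have hwin := PocketMoments.window_le_pairSum w A o (j + 1) (k / 2)
  -- lower bound for the window weight
  have hmid : μ.real {ω : BondConfig (Fin n) | j + 1 ≤ Nf ω ∧ Nf ω ≤ k / 2} ≤ (4 * m + 8) * t := by
    by_cases hsmall : k < 2 * m
    · -- small `k`: the window `[1, k/2]` costs `≤ k t ≤ 2m t`
      have hwin1 := PocketMoments.window_le_pairSum w A o 1 (k / 2)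
      have hsub : {ω : BondConfig (Fin n) | j + 1 ≤ Nf ω ∧ Nf ω ≤ k / 2} ⊆
          {ω : BondConfig (Fin n) | 1 ≤ (A.filter fun a => ω ∈ openConn o a).card ∧
            (A.filter fun a => ω ∈ openConn o a).card ≤ k / 2} := fun ω hω =>
        ⟨le_trans (Nat.succ_le_succ (Nat.zero_le j)) hω.1, hω.2⟩
      have hmono := measureReal_mono (μ := μ) hsub (measure_ne_top _ _)
      rcases Nat.lt_or_ge k 2 with hk2 | hk2
      · -- `k = 1`: the window is empty
        have hk0 : k / 2 = 0 := by omega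
        have hempty : {ω : BondConfig (Fin n) | j + 1 ≤ Nf ω ∧ Nf ω ≤ k / 2} = ∅ := by
          ext ω
          simp only [mem_setOf_eq, mem_empty_iff_false, iff_false, not_and, hk0]
          intro h1 h2
          have : 1 ≤ Nf ω := le_trans (Nat.succ_le_succ (Nat.zero_le j)) h1
          omega
        rw [hempty, measureReal_empty]; positivity
      · -- `2 ≤ k < 2m`: `min(1·(k−1), (k/2)(k − k/2)) ≥ k − 1 ≥ k/2`
        have hL : ((k : ℝ) - 1) ≤ min (((1 : ℕ) : ℝ) * ((A.card : ℝ) - ((1 : ℕ) : ℝ)))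
            (((k / 2 : ℕ) : ℝ) * ((A.card : ℝ) - ((k / 2 : ℕ) : ℝ))) := by
          rw [le_min_iff]
          constructor
          · simp [hk]
          · have h2 : 2 * (k / 2) ≤ k := Nat.mul_div_le k 2
            have h3 : k < 2 * (k / 2) + 2 := by omega
            have hq1 : (1 : ℝ) ≤ (k / 2 : ℕ) := by exact_mod_cast (show 1 ≤ k / 2 by omega)
            have hq2 : ((k / 2 : ℕ) : ℝ) * 2 ≤ k := by exact_mod_cast (by omega : (k / 2) * 2 ≤ k)
            have hkr : ((A.card : ℕ) : ℝ) = k := by rw [hk]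
            rw [hkr]
            nlinarith
        have hkpos : (0 : ℝ) < (k : ℝ) - 1 + 1 := by linarith
        have hk1' : (1 : ℝ) ≤ (k : ℝ) - 1 := by
          have : (2 : ℝ) ≤ k := by exact_mod_cast hk2
          linarith
        -- `(k-1) μ ≤ k² t` hence `μ ≤ k² t/(k−1) ≤ 2k t ≤ 4m t`
        have hkk : (A.card : ℝ) = k := by rw [hk]
        have e1 : ((k : ℝ) - 1) * μ.real {ω : BondConfig (Fin n) | 1 ≤ (A.filter fun a => ω ∈ openConn o a).card ∧
            (A.filter fun a => ω ∈ openConn o a).card ≤ k / 2} ≤ (k : ℝ) * k * t := by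
          have hnn : 0 ≤ μ.real {ω : BondConfig (Fin n) | 1 ≤ (A.filter fun a => ω ∈ openConn o a).card ∧
            (A.filter fun a => ω ∈ openConn o a).card ≤ k / 2} := measureReal_nonneg
          calc ((k : ℝ) - 1) * μ.real _ ≤ min (((1 : ℕ) : ℝ) * ((A.card : ℝ) - ((1 : ℕ) : ℝ)))
                (((k / 2 : ℕ) : ℝ) * ((A.card : ℝ) - ((k / 2 : ℕ) : ℝ))) * μ.real _ :=
                mul_le_mul_of_nonneg_right hL hnn
            _ ≤ _ := hwin1
            _ ≤ (A.card : ℝ) * (A.card : ℝ) * t := hpairs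
            _ = (k : ℝ) * k * t := by rw [hkk]
        have hkm : (k : ℝ) < 2 * m := by exact_mod_cast hsmall
        have e2 : (k : ℝ) * k * t ≤ ((k : ℝ) - 1) * ((4 * m + 8) * t) := by
          have hk2r : (2 : ℝ) ≤ k := by exact_mod_cast hk2
          have h := mul_le_mul_of_nonneg_right (window_arith_small (k : ℝ) m hk2r hkm) ht
          linarith [h]
        have e3 : ((k : ℝ) - 1) * μ.real {ω : BondConfig (Fin n) | j + 1 ≤ Nf ω ∧ Nf ω ≤ k / 2} ≤
            ((k : ℝ) - 1) * ((4 * m + 8) * t) :=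
          (mul_le_mul_of_nonneg_left hmono (by linarith)).trans (e1.trans e2)
        exact le_of_mul_le_mul_left e3 (by linarith)
    · -- large `k ≥ 2m`: `min((j+1)(k−j−1), (k/2)(k−k/2)) ≥ k²/(2m+8)`
      have hsmall' : 2 * m ≤ k := not_lt.1 hsmall
      have hkm : (2 : ℝ) * m ≤ k := by exact_mod_cast hsmall'
      have hm0 : 0 < m := by omega
      have hj1 : (k : ℝ) ≤ m * ((j : ℝ) + 1) := by
        have h : k < m * (k / m + 1) := Nat.lt_mul_div_succ k hm0
        have h' : (k : ℝ) < m * ((j : ℝ) + 1) := by rw [hj]; exact_mod_cast h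
        exact h'.le
      have hj2 : 3 * (((j : ℝ) + 1) - 1) ≤ k := by
        have h : m * (k / m) ≤ k := Nat.mul_div_le k m
        have h' : (m : ℝ) * j ≤ k := by rw [hj]; exact_mod_cast h
        have hj0 : (0 : ℝ) ≤ j := by exact_mod_cast Nat.zero_le j
        nlinarith
      have hq2 : ((k / 2 : ℕ) : ℝ) * 2 ≤ k := by exact_mod_cast (by omega : (k / 2) * 2 ≤ k)
      have hq3 : (k : ℝ) < ((k / 2 : ℕ) : ℝ) * 2 + 2 := by
        exact_mod_cast (by omega : k < (k / 2) * 2 + 2)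
      have hkk : (A.card : ℝ) = k := by rw [hk]
      have hL : (k : ℝ) * k / (2 * m + 8) ≤ min ((((j + 1 : ℕ)) : ℝ) * ((A.card : ℝ) - ((j + 1 : ℕ) : ℝ)))
          (((k / 2 : ℕ) : ℝ) * ((A.card : ℝ) - ((k / 2 : ℕ) : ℝ))) := by
        rw [hkk, le_min_iff]
        constructor
        · have e : (((j + 1 : ℕ)) : ℝ) = (j : ℝ) + 1 := by push_cast; ring
          rw [e]
          exact window_arith_low (k : ℝ) m ((j : ℝ) + 1) hmr hkm hj1 hj2
        · exact window_arith_high (k : ℝ) m ((k / 2 : ℕ) : ℝ) hmr hkm hq2 hq3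
      have hnn : 0 ≤ μ.real {ω : BondConfig (Fin n) | j + 1 ≤ Nf ω ∧ Nf ω ≤ k / 2} := measureReal_nonneg
      have e1 : (k : ℝ) * k / (2 * m + 8) * μ.real {ω : BondConfig (Fin n) | j + 1 ≤ Nf ω ∧ Nf ω ≤ k / 2} ≤
          (k : ℝ) * k * t :=
        calc (k : ℝ) * k / (2 * m + 8) * μ.real _
            ≤ min ((((j + 1 : ℕ)) : ℝ) * ((A.card : ℝ) - ((j + 1 : ℕ) : ℝ)))
                (((k / 2 : ℕ) : ℝ) * ((A.card : ℝ) - ((k / 2 : ℕ) : ℝ))) * μ.real _ :=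
              mul_le_mul_of_nonneg_right hL hnn
          _ ≤ _ := by simpa only [hNf] using hwin
          _ ≤ (A.card : ℝ) * (A.card : ℝ) * t := hpairs
          _ = (k : ℝ) * k * t := by rw [hkk]
      have hkk0 : (0 : ℝ) < (k : ℝ) * k := by nlinarith
      have e2 : μ.real {ω : BondConfig (Fin n) | j + 1 ≤ Nf ω ∧ Nf ω ≤ k / 2} ≤ (2 * m + 8) * t := by
        have hmpos : (0 : ℝ) < 2 * m + 8 := by linarith
        have := e1
        rw [div_mul_eq_mul_div, div_le_iff₀ hmpos] at this
        nlinarith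
      nlinarith
  -- (3) assemble
  have hsplit : {ω : BondConfig (Fin n) | 0 < Nf ω ∧ 2 * Nf ω ≤ A.card} ⊆
      {ω : BondConfig (Fin n) | 1 ≤ Nf ω ∧ Nf ω ≤ j} ∪ {ω : BondConfig (Fin n) | j + 1 ≤ Nf ω ∧ Nf ω ≤ k / 2} := by
    intro ω hω
    obtain ⟨h0, h2⟩ := hω
    by_cases hle : Nf ω ≤ j
    · exact Or.inl ⟨h0, hle⟩
    · refine Or.inr ⟨by omega, ?_⟩
      show Nf ω ≤ k / 2
      omega
  calc μ.real {ω : BondConfig (Fin n) | 0 < Nf ω ∧ 2 * Nf ω ≤ A.card}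
      ≤ μ.real ({ω : BondConfig (Fin n) | 1 ≤ Nf ω ∧ Nf ω ≤ j} ∪
          {ω : BondConfig (Fin n) | j + 1 ≤ Nf ω ∧ Nf ω ≤ k / 2}) := measureReal_mono hsplit (measure_ne_top _ _)
    _ ≤ μ.real {ω : BondConfig (Fin n) | 1 ≤ Nf ω ∧ Nf ω ≤ j} +
          μ.real {ω : BondConfig (Fin n) | j + 1 ≤ Nf ω ∧ Nf ω ≤ k / 2} := measureReal_union_le _ _
    _ ≤ (2 * t + C * (δ₀ + t)) + (4 * m + 8) * t := add_le_add hlow hmid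
    _ ≤ (C + 4 * m + 10) * (δ₀ + t) := by nlinarith

/-- **The lossy pocket cover with any constant, at any window level `|A|/m` (`m ≥ 3`), closes the crux.**  If for
some `m ≥ 3`, `C ≥ 0`, every finite weighted graph, every relay set `A ∌ o` with `A ≠ ∅` and every pairwise budget
`t` admit a relay `c ∈ A` and an admissible slack `Δ ≥ 0` (per realised pocket state with `R ≠ ∅`, `c ∉ R`:
`μ{port block small inside Wᶜ} ≤ μ{c small in G[Wᶜ] + K_R} + Δ(W,R)`, level `|A|/m`) with
`Σ_{W,R} Δ(W,R) μ(P_{W,R}) ≤ C (μ(o ↮ A) + t)`, then `NoHeavyLowerTail`. [this work] -/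
theorem noHeavyLowerTail_of_fewPortCoverConst (m : ℕ) (C : ℝ) (hm : 3 ≤ m) (hC : 0 ≤ C)
    (hcov : ∀ (n : ℕ) (w : Sym2 (Fin n) → unitInterval) (A : Finset (Fin n)) (o : Fin n) (t : ℝ),
      0 ≤ t → o ∉ A → A.Nonempty →
      (∀ a ∈ A, ∀ a' ∈ A, (prodBernoulli w).real (openConn a a' : Set (BondConfig (Fin n)))ᶜ ≤ t) →
      ∃ c ∈ A, ∃ Δ : Finset (Fin n) → Finset (Fin n) → ℝ, (∀ W N, 0 ≤ Δ W N) ∧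
        (∀ W N : Finset (Fin n),
          ({ω : BondConfig (Fin n) |
              (Finset.univ.filter fun v => ω ∈ openConnIn ((↑A : Set (Fin n))ᶜ) o v) = W ∧
              (A.filter fun a => ω ∈ openConnIn (insert a ((↑A : Set (Fin n))ᶜ)) o a) = N} : Set _).Nonempty →
          N.Nonempty → c ∉ N →
            (prodBernoulli w).real {ω : BondConfig (Fin n) |
                (A.filter fun y => ∃ a ∈ N, ω ∈ openConnIn ((↑W : Set (Fin n))ᶜ) a y).card ≤ A.card / m} ≤
              (prodBernoulli w).real {ω : BondConfig (Fin n) |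
                ((∃ a ∈ N, ω ∈ openConnIn ((↑W : Set (Fin n))ᶜ) c a) ∧
                    (A.filter fun y => ∃ a ∈ N, ω ∈ openConnIn ((↑W : Set (Fin n))ᶜ) a y).card ≤ A.card / m) ∨
                  ((¬ ∃ a ∈ N, ω ∈ openConnIn ((↑W : Set (Fin n))ᶜ) c a) ∧
                    (A.filter fun y => ω ∈ openConnIn ((↑W : Set (Fin n))ᶜ) c y).card ≤ A.card / m)} +
                Δ W N) ∧
        ∑ W : Finset (Fin n), ∑ N : Finset (Fin n), Δ W N *
            (prodBernoulli w).real {ω : BondConfig (Fin n) |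
              (Finset.univ.filter fun v => ω ∈ openConnIn ((↑A : Set (Fin n))ᶜ) o v) = W ∧
              (A.filter fun a => ω ∈ openConnIn (insert a ((↑A : Set (Fin n))ᶜ)) o a) = N} ≤
          C * ((prodBernoulli w).real (⋃ a ∈ A, (openConn o a : Set (BondConfig (Fin n))))ᶜ + t)) :
    Summit.CriticalPhenomena.PercolationContinuityZ3.Theses.PercNearOneGluing.NoHeavyLowerTail := by
  refine noHeavyLowerTail_of_fatMinorityLinear ⟨0, C + 4 * m + 10, by positivity, fun n w A o η hη hoA hpair => ?_⟩
  rcases A.eq_empty_or_nonempty with hAe | hAne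
  · have hempty : {ω : BondConfig (Fin n) |
        0 < (A.filter fun a => ω ∈ openConn o a).card ∧
          2 * (A.filter fun a => ω ∈ openConn o a).card ≤ A.card} = ∅ := by
      ext ω; simp [hAe]
    rw [hempty, measureReal_empty]
    have : 0 ≤ (prodBernoulli w).real (⋃ a ∈ A, (openConn o a : Set (BondConfig (Fin n))))ᶜ :=
      measureReal_nonneg
    positivity
  · obtain ⟨c, hc, Δ, hΔ0, hΔ, hsum⟩ := hcov n w A o η hη hoA hAne hpair
    exact lowerTail_half_le_of_fewPortCover w A o c m hm C η hη hoA hc hpair Δ hΔ0 hΔ hsum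

/-! ### Modulus form: a cover defect that merely TENDS TO ZERO (uniformly in the graph and in `|A|`) suffices -/

/-- **The lossy pocket cover with a DEFECT TENDING TO ZERO closes the crux (modulus form).**  If for some `m ≥ 3`, for every
`ε > 0` there is `τ > 0` such that every finite weighted graph with pairwise relay disconnections `≤ τ` and `μ(o ↮ A) ≤ τ`
(`o ∉ A ≠ ∅`) admits a relay `c ∈ A` and an admissible slack `Δ ≥ 0` at level `|A|/m` with `Σ_{W,R} Δ(W,R) μ(P_{W,R}) ≤ ε`,
then `NoHeavyLowerTail` (constant form with budget `min τ ε' + ε'`, `C = 1`, then `Theorems.noHeavyLowerTail_of_manyFingersLargePocket`).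
This is the form the fixed-witness line can still hope for after its ratio form died (engine memo `ENGINE-g3.md` §5: padded
F1 gives `Σ ≈ (t+δ₀)^{3/4}`); any modulus, uniform in the graph and in `|A|`, suffices. [this work] -/
theorem noHeavyLowerTail_of_fewPortCoverModulus (m : ℕ) (hm : 3 ≤ m)
    (hcov : ∀ ε : ℝ, 0 < ε → ∃ τ : ℝ, 0 < τ ∧
      ∀ (n : ℕ) (w : Sym2 (Fin n) → unitInterval) (A : Finset (Fin n)) (o : Fin n),
      o ∉ A → A.Nonempty →
      (∀ a ∈ A, ∀ a' ∈ A, (prodBernoulli w).real (openConn a a' : Set (BondConfig (Fin n)))ᶜ ≤ τ) →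
      (prodBernoulli w).real (⋃ a ∈ A, (openConn o a : Set (BondConfig (Fin n))))ᶜ ≤ τ →
      ∃ c ∈ A, ∃ Δ : Finset (Fin n) → Finset (Fin n) → ℝ, (∀ W N, 0 ≤ Δ W N) ∧
        (∀ W N : Finset (Fin n),
          ({ω : BondConfig (Fin n) |
              (Finset.univ.filter fun v => ω ∈ openConnIn ((↑A : Set (Fin n))ᶜ) o v) = W ∧
              (A.filter fun a => ω ∈ openConnIn (insert a ((↑A : Set (Fin n))ᶜ)) o a) = N} : Set _).Nonempty →
          N.Nonempty → c ∉ N →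
            (prodBernoulli w).real {ω : BondConfig (Fin n) |
                (A.filter fun y => ∃ a ∈ N, ω ∈ openConnIn ((↑W : Set (Fin n))ᶜ) a y).card ≤ A.card / m} ≤
              (prodBernoulli w).real {ω : BondConfig (Fin n) |
                ((∃ a ∈ N, ω ∈ openConnIn ((↑W : Set (Fin n))ᶜ) c a) ∧
                    (A.filter fun y => ∃ a ∈ N, ω ∈ openConnIn ((↑W : Set (Fin n))ᶜ) a y).card ≤ A.card / m) ∨
                  ((¬ ∃ a ∈ N, ω ∈ openConnIn ((↑W : Set (Fin n))ᶜ) c a) ∧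
                    (A.filter fun y => ω ∈ openConnIn ((↑W : Set (Fin n))ᶜ) c y).card ≤ A.card / m)} +
                Δ W N) ∧
        ∑ W : Finset (Fin n), ∑ N : Finset (Fin n), Δ W N *
            (prodBernoulli w).real {ω : BondConfig (Fin n) |
              (Finset.univ.filter fun v => ω ∈ openConnIn ((↑A : Set (Fin n))ᶜ) o v) = W ∧
              (A.filter fun a => ω ∈ openConnIn (insert a ((↑A : Set (Fin n))ᶜ)) o a) = N} ≤ ε) :
    Summit.CriticalPhenomena.PercolationContinuityZ3.Theses.PercNearOneGluing.NoHeavyLowerTail := by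
  refine noHeavyLowerTail_of_manyFingersLargePocket fun ε hε => ?_
  have hM : (0 : ℝ) < 4 * m + 11 := by
    have : (0 : ℝ) ≤ m := by exact_mod_cast Nat.zero_le m
    linarith
  set ε' : ℝ := ε / (3 * (4 * m + 11)) with hε'
  have hε'0 : 0 < ε' := by rw [hε']; positivity
  obtain ⟨τ, hτ, hcov'⟩ := hcov ε' hε'0
  refine ⟨min τ ε', 0, 0, lt_min hτ hε'0, fun n w A o a₀ ha₀ ho hpair hobs => ?_⟩
  have hAne : A.Nonempty := ⟨a₀, ha₀⟩
  obtain ⟨c, hc, Δ, hΔ0, hΔ, hsum⟩ := hcov' n w A o ho hAne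
    (fun a ha a' ha' => (hpair a ha a' ha').trans (min_le_left _ _)) (hobs.trans (min_le_left _ _))
  -- the constant form with budget `t' = min τ ε' + ε'` and `C = 1` gives the additive bound
  set t' : ℝ := min τ ε' + ε' with ht'
  have ht'0 : 0 ≤ t' := by rw [ht']; exact add_nonneg (le_min hτ.le hε'0.le) hε'0.le
  have hpair' : ∀ a ∈ A, ∀ a' ∈ A, (prodBernoulli w).real (openConn a a' : Set (BondConfig (Fin n)))ᶜ ≤ t' :=
    fun a ha a' ha' => (hpair a ha a' ha').trans (by rw [ht']; linarith)
  have hδ0 : 0 ≤ (prodBernoulli w).real (⋃ a ∈ A, (openConn o a : Set (BondConfig (Fin n))))ᶜ := measureReal_nonneg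
  have hsum' : ∑ W : Finset (Fin n), ∑ N : Finset (Fin n), Δ W N *
          (prodBernoulli w).real {ω : BondConfig (Fin n) |
            (Finset.univ.filter fun v => ω ∈ openConnIn ((↑A : Set (Fin n))ᶜ) o v) = W ∧
            (A.filter fun a => ω ∈ openConnIn (insert a ((↑A : Set (Fin n))ᶜ)) o a) = N} ≤
        1 * ((prodBernoulli w).real (⋃ a ∈ A, (openConn o a : Set (BondConfig (Fin n))))ᶜ + t') :=
    hsum.trans (by rw [ht']; linarith [le_min hτ.le hε'0.le])
  have hhalf := lowerTail_half_le_of_fewPortCover w A o c m hm 1 t' ht'0 ho hc hpair' Δ hΔ0 hΔ hsum'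
  have hfilter : ∀ ω : BondConfig (Fin n), ω ∉ openConn o a₀ →
      (A.filter fun a => ω ∈ openConn o a) = ((A.erase a₀).filter fun a => ω ∈ openConn o a) := by
    intro ω hω
    rw [Finset.filter_erase, Finset.erase_eq_of_notMem]
    simp [Finset.mem_filter, hω]
  calc (prodBernoulli w).real {ω : BondConfig (Fin n) | ω ∉ openConn o a₀ ∧
          0 ≤ ((A.erase a₀).filter fun a => ω ∈ openConn o a).card ∧
          2 * ((A.erase a₀).filter fun a => ω ∈ openConn o a).card ≤ A.card ∧
          0 < (A.filter fun a => ω ∈ openConnIn ((↑A : Set (Fin n))ᶜ ∪ {o, a}) o a).card}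
      ≤ (prodBernoulli w).real {ω : BondConfig (Fin n) |
          0 < (A.filter fun a => ω ∈ openConn o a).card ∧
          2 * (A.filter fun a => ω ∈ openConn o a).card ≤ A.card} := by
        refine measureReal_mono (fun ω hω => ?_) (measure_ne_top _ _)
        simp only [Set.mem_setOf_eq] at hω ⊢
        obtain ⟨h1, -, h3, h4⟩ := hω
        refine ⟨lt_of_lt_of_le h4 (Finset.card_le_card ?_), by rw [hfilter ω h1]; exact h3⟩
        intro a
        simp only [Finset.mem_filter]
        exact fun ha => ⟨ha.1, openConnIn_subset_openConn _ _ _ ha.2⟩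
    _ ≤ (1 + 4 * m + 10) * ((prodBernoulli w).real (⋃ a ∈ A, (openConn o a : Set (BondConfig (Fin n))))ᶜ + t') := hhalf
    _ ≤ (1 + 4 * m + 10) * (ε' + (ε' + ε')) := by
        gcongr
        · exact hobs.trans (min_le_right _ _)
        · rw [ht']; exact add_le_add (min_le_right _ _) le_rfl
    _ = ε := by rw [hε']; field_simp; ring

end LossyPocket

end Summit.CriticalPhenomena.PercolationContinuityZ3.Theorems

end
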